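import Literature.Topology.FourManifolds.OpenManifoldTriads
import Literature.Topology.FourManifolds.RegularSublevelAmbient
import Literature.Topology.FourManifolds.LevelBlending
import HarnessLib

/-!
# A proper Morse function without critical points of top index on an open manifold
# (Phillips 1967, Lemma 1.1, as printed)

Topic `Literature/Topology/FourManifolds`; consumer: the named fact
`Literature.Topology.Immersions.Phillips1967_exists_isLocalDiffeomorph_of_isParallelizable`
(Phillips' Cor. 8.2), whose printed proof starts from this lemma. Everything here is
**proved**; no definitions, no named facts.

Phillips 1967, Lemma 1.1 (p. 176): *"An open `n`-dimensional manifold `M` has a non-negative,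
proper Morse function with no critical points of index `n`."*  The tree's
`OpenManifoldTriads.lean` carries out the printed proof up to the sentence *"The `fᵢ` can be
fitted together to give a non-negative, proper Morse function `f` on `M`"*: it exhausts `M` by
the compact hulls `Mᵢ'` of regular sublevel sets and puts on every triad
`(Mᵢ₊₁' - Int Mᵢ'; ∂Mᵢ', ∂Mᵢ₊₁')` a Morse function in the sense of Milnor's triads without
critical points of index `n = k + 1` (Milnor 1965, Thm. 2.5 and Thm. 8.1 Index 0 with the
hypothesis `H₀ = 0` supplied by the hulls). This file performs the fitting:

* `IsRegularPair.exists_normalisedFn` — **one triad, read on `M` and normalised near its two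
  boundary levels**: the triad Morse function is extended to a smooth function on `M` (Seeley,
  `RegularSublevel.exists_contMDiff_forall_eq_comp_incl`), and blended into `λ₁ F₁` near
  `∂Mᵢ' = {F₁ = 0}` and into `1 + λ₂ F₂` near `∂Mᵢ₊₁' = {F₂ = 0}` without creating critical
  points (`LevelBlending.exists_blend_eq_mul_near_level`, twice; `F₁`, `F₂` are the regular
  defining functions of the two hulls, `HullRegularSublevel.lean`); the thresholds `λ₁ ≤ Λ₁`,
  `λ₂ ≤ Λ₂` can be prescribed, so that adjacent triads can be given the same slope at their
  common level. On the triad the result has values in `[0, 1]`, and its critical points there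
  are interior, nondegenerate, of index `≤ k` (transfer of criticality and Hessians between the
  triad and `M`, `RegularSublevelAmbient.lean`).
* `exists_isMorse_tendsto_cocompact_forall_morseIndex_le` — **Lemma 1.1**: on an open `C^∞`
  manifold `M` modelled on `ℝᵏ⁺¹` (Hausdorff, second countable, no compact component) there is
  a proper Morse function `f ≥ 0` all of whose critical points have index `≤ k`, i.e. none of
  index `k + 1 = dim M` (`criticalSetOfIndex f (k + 1) = ∅`,
  `exists_isMorse_tendsto_cocompact_criticalSetOfIndex_top_eq_empty`). The global function is
  `f = (i + 1) + Gᵢ` on the `i`-th triad, the normalised functions `Gᵢ` of consecutive triads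
  having been given the same slope at their common level, where `f = (i + 2) + λᵢ₊₁ Fᵢ₊₁` on a
  two-sided neighbourhood.

## References

* A. Phillips, *Submersions of open manifolds*, Topology **6** (1967), Lemma 1.1 and its
  proof (p. 176). [Phillips1967]
* J. Milnor, *Lectures on the h-cobordism theorem* (1965), Thm. 2.5, Thm. 8.1. [MilnorHCobordism1965]
-/

open scoped Manifold ContDiff Topology
open Set Function Filter

noncomputable section

universe u

namespace Literature.Topology.FourManifolds

variable {k : ℕ} {M : Type u} [TopologicalSpace M] [T2Space M] [SecondCountableTopology M]
  [ChartedSpace (EuclideanSpace ℝ (Fin (k + 1))) M] [IsManifold (𝓡 (k + 1)) ∞ M]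

namespace IsRegularPair

variable {f : M → ℝ} {a₁ a₂ : ℝ} (h : IsRegularPair k f a₁ a₂)

/-! ### The triad Morse function read on `M` -/

/-- A point of the triad is interior iff `0 < F₁` and `F₂ < 0` there. [folklore] -/
theorem isInteriorPoint_triad_iff (p : h.Triad) :
    (𝓡∂ (k + 1)).IsInteriorPoint p ↔ 0 < h.fn₁ p.1 ∧ h.fn₂ p.1 < 0 := by
  rw [RegularSublevel.isInteriorPoint_iff]
  have hp : h.triadFn p.1 ≤ 0 := p.2
  obtain ⟨h2, h1⟩ := (h.triadFn_nonpos_iff p.1).1 hp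
  constructor
  · intro hlt
    have hne : h.triadFn p.1 ≠ 0 := hlt.ne
    rw [Ne, h.triadFn_eq_zero_iff, not_or] at hne
    exact ⟨lt_of_le_of_ne h1 (Ne.symm hne.1), lt_of_le_of_ne h2 hne.2⟩
  · rintro ⟨h1', h2'⟩
    show h.fn₁ p.1 * h.fn₂ p.1 < 0
    exact mul_neg_of_pos_of_neg h1' h2'

/-- A point of the triad is a boundary point iff `F₁ = 0` or `F₂ = 0` there. [folklore] -/
theorem isBoundaryPoint_triad_iff (p : h.Triad) :
    (𝓡∂ (k + 1)).IsBoundaryPoint p ↔ h.fn₁ p.1 = 0 ∨ h.fn₂ p.1 = 0 := by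
  rw [RegularSublevel.isBoundaryPoint_iff, ← h.triadFn_eq_zero_iff]; rfl

/-- **The values of a triad Morse function, read through `F₁`, `F₂`**: `g = 0` where `F₁ = 0`,
`g = 1` where `F₂ = 0`, `dg ≠ 0` there, `g ∈ [0, 1]` everywhere. [cite: MilnorHCobordism1965, Def. 2.3] -/
theorem isMorseFunction_values {g : h.Triad → ℝ} (hg : h.cobordism.IsMorseFunction g) :
    (∀ p : h.Triad, h.fn₁ p.1 = 0 → g p = 0) ∧ (∀ p : h.Triad, h.fn₂ p.1 = 0 → g p = 1) ∧
    (∀ p : h.Triad, h.fn₁ p.1 = 0 ∨ h.fn₂ p.1 = 0 → ¬ IsMCriticalPt (𝓡∂ (k + 1)) g p) ∧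
    (∀ p : h.Triad, g p ∈ Icc (0 : ℝ) 1) := by
  have hg' := hg
  obtain ⟨-, h0, h1, hbd, -⟩ := hg'
  refine ⟨fun p hp => ?_, fun p hp => ?_, fun p hp => ?_, fun p => hg.mem_Icc p⟩
  · have hb : p ∈ (𝓡∂ (k + 1)).boundary h.Triad := (h.isBoundaryPoint_triad_iff p).2 (Or.inl hp)
    have hmem : (⟨p, hb⟩ : (𝓡∂ (k + 1)).boundary h.Triad) ∈ h.botEnd := (h.mem_botEnd_iff _).2 hp
    exact h0 ⟨⟨p, hb⟩, hmem⟩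
  · have hb : p ∈ (𝓡∂ (k + 1)).boundary h.Triad := (h.isBoundaryPoint_triad_iff p).2 (Or.inr hp)
    have hmem : (⟨p, hb⟩ : (𝓡∂ (k + 1)).boundary h.Triad) ∈ h.topEnd := (h.mem_topEnd_iff _).2 hp
    exact h1 ⟨⟨p, hb⟩, hmem⟩
  · exact hbd p ((h.isBoundaryPoint_triad_iff p).2 hp)

/-- `{|F| ≤ 1}`-type bands of the hull functions are compact when `f` is proper. [folklore] -/
theorem isCompact_preimage_fn₁_Icc (hprop : ∀ b, IsCompact (f ⁻¹' Iic b)) (η : ℝ) :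
    IsCompact (h.fn₁ ⁻¹' Icc (-η) η) := by
  obtain ⟨C, hC⟩ := h.exists_le_fn₁_add
  refine (hprop (η + C)).of_isClosed_subset (isClosed_Icc.preimage h.contMDiff_fn₁.continuous)
    fun y hy => ?_
  have := hC y
  have hy2 : h.fn₁ y ≤ η := hy.2
  show f y ≤ η + C
  linarith

/-- The same for `F₂` (and for `-F₂`). [folklore] -/
theorem isCompact_preimage_neg_fn₂_Icc (hprop : ∀ b, IsCompact (f ⁻¹' Iic b)) (η : ℝ) :
    IsCompact ((fun y => -h.fn₂ y) ⁻¹' Icc (-η) η) := by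
  obtain ⟨C, hC⟩ := h.exists_le_fn₂_add
  refine (hprop (η + C)).of_isClosed_subset
    (isClosed_Icc.preimage (h.contMDiff_fn₂.continuous.neg)) fun y hy => ?_
  have := hC y
  have hy' : -h.fn₂ y ∈ Icc (-η) η := hy
  have hy1 : -η ≤ -h.fn₂ y := hy'.1
  show f y ≤ η + C
  linarith

/-! ### One triad, read on `M` and normalised near its boundary levels -/

/-- **A triad Morse function without top-index critical points, extended to `M` and
normalised near the two boundary levels.** For a regular pair of levels of a proper smooth
`f` there are thresholds `Λ₁, Λ₂ > 0` such that for all slopes `0 < λ₁ ≤ Λ₁`, `0 < λ₂ ≤ Λ₂`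
there is a smooth `G : M → ℝ` and widths `δ₁, δ₂ > 0` with

* `G = λ₁ F₁` on `{F₁ ≤ δ₁}` and `G = 1 + λ₂ F₂` on `{-δ₂ ≤ F₂}` (`F₁`, `F₂` the regular
  defining functions of the hulls `M₁' = {F₁ ≤ 0}`, `M₂' = {F₂ ≤ 0}`);
* on the triad `{0 ≤ F₁} ∩ {F₂ ≤ 0}`: `0 ≤ G ≤ 1`, and every critical point of `G` there lies
  in the interior `{0 < F₁} ∩ {F₂ < 0}`, is nondegenerate and has Morse index `≤ k`.

Proof: a Morse function `g` of the triad cobordism without critical points of index `k + 1`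
(`exists_isMorseFunction_criticalSetOfIndex_top_eq_empty`: Milnor 1965 Thms. 2.5, 8.1 via
Phillips' `H₀ = 0`), extended to `M` by Seeley's theorem and blended into `λ₁ F₁`, resp.
`1 + λ₂ F₂`, near the two levels by `LevelBlending.exists_blend_eq_mul_near_level`; critical
points and Hessians off the blending zones are those of `g` (`RegularSublevelAmbient.lean`).
This is the normal form which lets *"the `fᵢ` be fitted together"*.
[cite: Phillips1967, proof of Lemma 1.1 (p. 176)] -/
theorem exists_normalisedFn (hprop : ∀ b, IsCompact (f ⁻¹' Iic b)) :
    ∃ Λ₁ Λ₂ : ℝ, 0 < Λ₁ ∧ 0 < Λ₂ ∧ ∀ lam₁ lam₂ : ℝ, 0 < lam₁ → lam₁ ≤ Λ₁ → 0 < lam₂ → lam₂ ≤ Λ₂ →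
      ∃ (G : M → ℝ) (δ₁ δ₂ : ℝ), ContMDiff (𝓡 (k + 1)) 𝓘(ℝ, ℝ) ∞ G ∧ 0 < δ₁ ∧ 0 < δ₂ ∧
        (∀ y, h.fn₁ y ≤ δ₁ → G y = lam₁ * h.fn₁ y) ∧
        (∀ y, -δ₂ ≤ h.fn₂ y → G y = 1 + lam₂ * h.fn₂ y) ∧
        (∀ y, 0 ≤ h.fn₁ y → h.fn₂ y ≤ 0 → G y ∈ Icc (0 : ℝ) 1) ∧
        (∀ y, 0 ≤ h.fn₁ y → h.fn₂ y ≤ 0 → IsMCriticalPt (𝓡 (k + 1)) G y →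
          (0 < h.fn₁ y ∧ h.fn₂ y < 0) ∧ (mhessian (𝓡 (k + 1)) G y).Nondegenerate ∧
            morseIndex (𝓡 (k + 1)) G y ≤ k) := by
  classical
  haveI : LocallyCompactSpace M :=
    ChartedSpace.locallyCompactSpace (EuclideanSpace ℝ (Fin (k + 1))) M
  haveI : SigmaCompactSpace M := sigmaCompactSpace_of_locallyCompact_secondCountable
  -- the triad Morse function and its extension to `M`
  obtain ⟨g, hg, hgtop⟩ := h.exists_isMorseFunction_criticalSetOfIndex_top_eq_empty
  obtain ⟨hg0, hg1, hgbd, hg01⟩ := h.isMorseFunction_values hg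
  obtain ⟨G, hGs, hGg⟩ :=
    RegularSublevel.exists_contMDiff_forall_eq_comp_incl h.isRegularLevel_triadFn hg.1.1
  have hGg' : (G ∘ RegularSublevel.incl h.isRegularLevel_triadFn : h.Triad → ℝ) = g :=
    funext hGg
  -- reading `g` through `G` on the triad `{0 ≤ F₁} ∩ {F₂ ≤ 0}`
  have hmem : ∀ y, 0 ≤ h.fn₁ y → h.fn₂ y ≤ 0 → h.triadFn y ≤ 0 := fun y h1 h2 =>
    (h.triadFn_nonpos_iff y).2 ⟨h2, h1⟩
  have hG0 : ∀ y, h.fn₁ y = 0 → G y = 0 := fun y hy => by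
    have hy' : h.triadFn y ≤ 0 := hmem y hy.ge (h.fn₂_neg_of_fn₁_nonpos hy.le).le
    rw [← hg0 ⟨y, hy'⟩ hy]; exact hGg ⟨y, hy'⟩
  have hG1 : ∀ y, h.fn₂ y = 0 → G y = 1 := fun y hy => by
    have hy' : h.triadFn y ≤ 0 := hmem y (h.fn₁_pos_of_fn₂_eq_zero hy).le hy.le
    rw [← hg1 ⟨y, hy'⟩ hy]; exact hGg ⟨y, hy'⟩
  have hG01 : ∀ y, 0 ≤ h.fn₁ y → h.fn₂ y ≤ 0 → G y ∈ Icc (0 : ℝ) 1 := fun y h1 h2 => by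
    have := hg01 ⟨y, hmem y h1 h2⟩
    rwa [← hGg ⟨y, hmem y h1 h2⟩] at this
  have hcrit : ∀ (y : M) (hy : h.triadFn y ≤ 0),
      (IsMCriticalPt (𝓡∂ (k + 1)) g ⟨y, hy⟩ ↔ IsMCriticalPt (𝓡 (k + 1)) G y) := fun y hy => by
    rw [← hGg']
    exact RegularSublevel.isMCriticalPt_comp_incl_iff h.isRegularLevel_triadFn hGs ⟨y, hy⟩
  have hGreg : ∀ y, h.fn₁ y = 0 ∨ h.fn₂ y = 0 → ¬ IsMCriticalPt (𝓡 (k + 1)) G y := by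
    intro y hy
    have hy' : h.triadFn y ≤ 0 := le_of_eq ((h.triadFn_eq_zero_iff y).2 hy)
    rw [← hcrit y hy']
    exact hgbd ⟨y, hy'⟩ hy
  -- the thresholds: bottom (`F₁`, `G`) and top (`-F₂`, `1 - G`)
  have hGpos₁ : ∀ x, h.fn₁ x = 0 → ∀ᶠ y in 𝓝 x, 0 ≤ h.fn₁ y → 0 ≤ G y := by
    intro x hx
    have hx2 : h.fn₂ x < 0 := h.fn₂_neg_of_fn₁_nonpos hx.le
    filter_upwards [(isOpen_lt h.contMDiff_fn₂.continuous continuous_const).mem_nhds hx2]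
      with y hy hy1
    exact (hG01 y hy1 (le_of_lt hy)).1
  have hGpos₂ : ∀ x, (fun y => -h.fn₂ y) x = 0 → ∀ᶠ y in 𝓝 x,
      0 ≤ (fun y => -h.fn₂ y) y → 0 ≤ (fun y => 1 - G y) y := by
    intro x hx
    have hx' : h.fn₂ x = 0 := by simpa using hx
    have hx1 : 0 < h.fn₁ x := h.fn₁_pos_of_fn₂_eq_zero hx'
    filter_upwards [(isOpen_lt continuous_const h.contMDiff_fn₁.continuous).mem_nhds hx1]
      with y hy hy2
    have hy2' : h.fn₂ y ≤ 0 := by simpa using hy2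
    have := (hG01 y (le_of_lt hy) hy2').2
    show 0 ≤ 1 - G y
    linarith
  have hF₂s : ContMDiff (𝓡 (k + 1)) 𝓘(ℝ, ℝ) ∞ fun y => -h.fn₂ y := h.contMDiff_fn₂.neg
  have h1Gs : ContMDiff (𝓡 (k + 1)) 𝓘(ℝ, ℝ) ∞ fun y => 1 - G y := contMDiff_const.sub hGs
  have hreg₂ : ∀ x, (fun y => -h.fn₂ y) x = 0 → ¬ IsMCriticalPt (𝓡 (k + 1)) (fun y => -h.fn₂ y) x := by
    intro x hx
    have hx' : h.fn₂ x = 0 := by simpa using hx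
    rw [show (fun y => -h.fn₂ y) = fun y => 0 - h.fn₂ y from funext fun y => by ring,
      LevelBlending.isMCriticalPt_const_sub_iff 0 (h.contMDiff_fn₂.mdifferentiableAt (by simp))]
    exact h.not_isMCriticalPt_fn₂ hx'
  have h1G0 : ∀ x, (fun y => -h.fn₂ y) x = 0 → (fun y => 1 - G y) x = 0 := by
    intro x hx
    have hx' : h.fn₂ x = 0 := by simpa using hx
    show 1 - G x = 0
    rw [hG1 x hx', sub_self]
  have h1Greg : ∀ x, (fun y => -h.fn₂ y) x = 0 → ¬ IsMCriticalPt (𝓡 (k + 1)) (fun y => 1 - G y) x := by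
    intro x hx
    have hx' : h.fn₂ x = 0 := by simpa using hx
    rw [LevelBlending.isMCriticalPt_const_sub_iff 1 (hGs.mdifferentiableAt (by simp))]
    exact hGreg x (Or.inr hx')
  obtain ⟨Λ₁, hΛ₁, hbot⟩ := LevelBlending.exists_blend_eq_mul_near_level h.contMDiff_fn₁ hGs
    one_pos (h.isCompact_preimage_fn₁_Icc hprop 1) (fun x hx => h.not_isMCriticalPt_fn₁ hx)
    hG0 (fun x hx => hGreg x (Or.inl hx)) hGpos₁
  obtain ⟨Λ₂, hΛ₂, htop⟩ := LevelBlending.exists_blend_eq_mul_near_level hF₂s h1Gs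
    one_pos (h.isCompact_preimage_neg_fn₂_Icc hprop 1) hreg₂ h1G0 h1Greg hGpos₂
  refine ⟨min Λ₁ 1, min Λ₂ 1, lt_min hΛ₁ one_pos, lt_min hΛ₂ one_pos,
    fun lam₁ lam₂ hl₁ hl₁m hl₂ hl₂m => ?_⟩
  have hl₁' : lam₁ ≤ Λ₁ := hl₁m.trans (min_le_left _ _)
  have hl₁1 : lam₁ ≤ 1 := hl₁m.trans (min_le_right _ _)
  have hl₂' : lam₂ ≤ Λ₂ := hl₂m.trans (min_le_left _ _)
  have hl₂1 : lam₂ ≤ 1 := hl₂m.trans (min_le_right _ _)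
  -- the bottom blend, inside `N₁ = {F₂ < 0} ∩ {F₁ < 1}`
  set N₁ : Set M := {y | h.fn₂ y < 0} ∩ {y | h.fn₁ y < 1} with hN₁
  have hN₁ : N₁ ∈ 𝓝ˢ (h.fn₁ ⁻¹' {0}) := by
    refine ((isOpen_lt h.contMDiff_fn₂.continuous continuous_const).inter
      (isOpen_lt h.contMDiff_fn₁.continuous continuous_const)).mem_nhdsSet.2 fun y hy => ?_
    have hy' : h.fn₁ y = 0 := hy
    exact ⟨h.fn₂_neg_of_fn₁_nonpos hy'.le, by rw [mem_setOf_eq, hy']; exact one_pos⟩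
  obtain ⟨δ₁, e₁, hδ₁, hδe₁, hband₁, G₁, hG₁s, hG₁low, hG₁high, hG₁crit, hG₁bd⟩ :=
    hbot lam₁ hl₁ hl₁' N₁ hN₁
  -- the top blend, inside `N₂ = {e₁ < F₁} ∩ {-1 < F₂}`
  set N₂ : Set M := {y | e₁ < h.fn₁ y} ∩ {y | -1 < h.fn₂ y} with hN₂
  have hN₂ : N₂ ∈ 𝓝ˢ ((fun y => -h.fn₂ y) ⁻¹' {0}) := by
    refine ((isOpen_lt continuous_const h.contMDiff_fn₁.continuous).inter
      (isOpen_lt continuous_const h.contMDiff_fn₂.continuous)).mem_nhdsSet.2 fun y hy => ?_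
    have hy' : h.fn₂ y = 0 := by simpa using hy
    refine ⟨?_, by rw [mem_setOf_eq, hy']; norm_num⟩
    -- `y ∉ {|F₁| ≤ e₁}` since that band lies in `N₁ ⊆ {F₂ < 0}`
    by_contra hle
    rw [mem_setOf_eq, not_lt] at hle
    have hpos : 0 < h.fn₁ y := h.fn₁_pos_of_fn₂_eq_zero hy'
    have hmemb : y ∈ {y | |h.fn₁ y| ≤ e₁} := by
      rw [mem_setOf_eq, abs_of_pos hpos]; exact hle
    have := (hband₁ hmemb).1
    rw [mem_setOf_eq, hy'] at this
    exact lt_irrefl _ this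
  obtain ⟨δ₂, e₂, hδ₂, hδe₂, hband₂, G₂, hG₂s, hG₂low, hG₂high, hG₂crit, hG₂bd⟩ :=
    htop lam₂ hl₂ hl₂' N₂ hN₂
  -- the normalised function: both corrections added to `G`
  set Gn : M → ℝ := fun y => G₁ y + (1 - G₂ y) - G y with hGn
  have hGns : ContMDiff (𝓡 (k + 1)) 𝓘(ℝ, ℝ) ∞ Gn := (hG₁s.add (contMDiff_const.sub hG₂s)).sub hGs
  -- where each correction is inactive
  have hGn_eq₁ : ∀ y, h.fn₂ y ≤ -e₂ → Gn y = G₁ y := fun y hy => by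
    have := hG₂high y (by show e₂ ≤ -h.fn₂ y; linarith)
    simp only [hGn, this]; ring
  have hGn_eq₂ : ∀ y, e₁ ≤ h.fn₁ y → Gn y = 1 - G₂ y := fun y hy => by
    simp only [hGn, hG₁high y hy]; ring
  -- key separation facts
  -- (a) on `{F₁ ≤ e₁}` (near the bottom, or inside `M₁'`): `F₂ < -e₂`
  have hsep₁ : ∀ y, h.fn₁ y ≤ e₁ → h.fn₂ y < -e₂ := by
    intro y hy
    have hneg : h.fn₂ y < 0 := by
      rcases le_or_gt (h.fn₁ y) (-e₁) with hle | hgt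
      · exact h.fn₂_neg_of_fn₁_nonpos (by linarith)
      · exact (hband₁ (show |h.fn₁ y| ≤ e₁ from abs_le.2 ⟨hgt.le, hy⟩)).1
    by_contra hge
    rw [not_lt] at hge
    -- then `y` is in the top band, hence in `N₂ ⊆ {e₁ < F₁}`
    have hmemb : y ∈ {y | |(fun y => -h.fn₂ y) y| ≤ e₂} := by
      show |-h.fn₂ y| ≤ e₂
      rw [abs_neg, abs_of_neg hneg]; linarith
    have := (hband₂ hmemb).1
    exact absurd this (not_lt.2 hy)
  -- (b) on `{-e₂ ≤ F₂}` (near the top, or outside `M₂'`): `e₁ < F₁`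
  have hsep₂ : ∀ y, -e₂ ≤ h.fn₂ y → e₁ < h.fn₁ y := by
    intro y hy
    by_contra hle
    rw [not_lt] at hle
    have := hsep₁ y hle
    linarith
  refine ⟨Gn, δ₁, δ₂, hGns, hδ₁, hδ₂, fun y hy => ?_, fun y hy => ?_, fun y h1 h2 => ?_,
    fun y h1 h2 hc => ?_⟩
  · -- bottom normal form
    rw [hGn_eq₁ y (hsep₁ y (by linarith)).le, hG₁low y hy]
  · -- top normal form
    rw [hGn_eq₂ y (hsep₂ y (by linarith)).le, hG₂low y (show -h.fn₂ y ≤ δ₂ by linarith)]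
    ring
  · -- values in `[0, 1]` on the triad
    rcases le_or_gt (h.fn₁ y) e₁ with hA | hB
    · -- `Gn = G₁`, a combination of `λ₁ F₁ ∈ [0, 1)` and `G ∈ [0, 1]`
      rw [hGn_eq₁ y (hsep₁ y hA).le]
      have hF1 : h.fn₁ y < 1 := (hband₁ (show |h.fn₁ y| ≤ e₁ from abs_le.2 ⟨by linarith, hA⟩)).2
      obtain ⟨hlo, hhi⟩ := hG₁bd y
      obtain ⟨hG0', hG1'⟩ := hG01 y h1 h2
      have hl1 : lam₁ * h.fn₁ y ≤ 1 := by nlinarith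
      have hl0 : 0 ≤ lam₁ * h.fn₁ y := mul_nonneg hl₁.le h1
      constructor
      · exact le_trans (le_min hl0 hG0') hlo
      · exact le_trans hhi (max_le hl1 hG1')
    · -- `Gn = 1 - G₂`
      rw [hGn_eq₂ y hB.le]
      rcases le_or_gt e₂ (-h.fn₂ y) with hfar | hnear
      · rw [hG₂high y hfar]
        have := hG01 y h1 h2
        constructor <;> linarith [this.1, this.2]
      · have hF2 : -1 < h.fn₂ y :=
          (hband₂ (show |(fun y => -h.fn₂ y) y| ≤ e₂ from by
            show |-h.fn₂ y| ≤ e₂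
            rw [abs_of_nonneg (by linarith)]; exact hnear.le)).2
        obtain ⟨hlo, hhi⟩ := hG₂bd y
        obtain ⟨hG0', hG1'⟩ := hG01 y h1 h2
        have hl0 : 0 ≤ lam₂ * -h.fn₂ y := mul_nonneg hl₂.le (by linarith)
        have hl1 : lam₂ * -h.fn₂ y ≤ 1 := by nlinarith
        have hmin : 0 ≤ min (lam₂ * (fun y => -h.fn₂ y) y) ((fun y => 1 - G y) y) :=
          le_min hl0 (by show 0 ≤ 1 - G y; linarith)
        have hmax : max (lam₂ * (fun y => -h.fn₂ y) y) ((fun y => 1 - G y) y) ≤ 1 :=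
          max_le hl1 (by show 1 - G y ≤ 1; linarith)
        constructor <;> [linarith [hhi.trans hmax]; linarith [hmin.trans hlo]]
  · -- critical points on the triad: interior, nondegenerate, of index `≤ k`
    rcases le_or_gt (h.fn₁ y) e₁ with hA | hB
    · -- zone A: `Gn = G₁` near `y`, and `G₁` has no critical point there
      exfalso
      have hev : Gn =ᶠ[𝓝 y] G₁ := by
        filter_upwards [(isOpen_lt h.contMDiff_fn₂.continuous continuous_const).mem_nhds
          (hsep₁ y hA)] with z hz
        exact hGn_eq₁ z (le_of_lt hz)
      rw [LevelBlending.isMCriticalPt_congr_of_eventuallyEq hev] at hc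
      exact hG₁crit y (by linarith) hA hc
    rcases le_or_gt (-e₂) (h.fn₂ y) with hC | hB'
    · -- zone C: `Gn = 1 - G₂` near `y`, and `G₂` has no critical point there
      exfalso
      have hev : Gn =ᶠ[𝓝 y] fun z => 1 - G₂ z := by
        filter_upwards [(isOpen_lt continuous_const h.contMDiff_fn₁.continuous).mem_nhds hB]
          with z hz
        exact hGn_eq₂ z (le_of_lt hz)
      rw [LevelBlending.isMCriticalPt_congr_of_eventuallyEq hev,
        LevelBlending.isMCriticalPt_const_sub_iff 1 (hG₂s.mdifferentiableAt (by simp))] at hc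
      exact hG₂crit y (by show -e₂ < -h.fn₂ y; linarith) (by show -h.fn₂ y ≤ e₂; linarith) hc
    · -- zone B: `Gn = G` near `y`, an interior point of the triad: read `g`
      have hev : Gn =ᶠ[𝓝 y] fun z => G z + 0 := by
        filter_upwards [((isOpen_lt continuous_const h.contMDiff_fn₁.continuous).inter
          (isOpen_lt h.contMDiff_fn₂.continuous continuous_const)).mem_nhds ⟨hB, hB'⟩]
          with z hz
        have hz1 : e₁ < h.fn₁ z := hz.1
        have hz2 : h.fn₂ z < -e₂ := hz.2
        have h1z := hG₁high z hz1.le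
        have h2z := hG₂high z (show e₂ ≤ -h.fn₂ z by linarith)
        simp only [hGn, h1z, h2z]; ring
      have hpos₁ : 0 < h.fn₁ y := by linarith
      have hneg₂ : h.fn₂ y < 0 := by linarith
      have hy : h.triadFn y ≤ 0 := hmem y h1 h2
      have hylt : h.triadFn y < 0 := by
        show h.fn₁ y * h.fn₂ y < 0
        exact mul_neg_of_pos_of_neg hpos₁ hneg₂
      set p : h.Triad := ⟨y, hy⟩ with hp
      have hcG : IsMCriticalPt (𝓡 (k + 1)) G y :=
        (isMCriticalPt_congr_of_eventuallyEq_add_const hev).1 hc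
      have hcg : IsMCriticalPt (𝓡∂ (k + 1)) g p := (hcrit y hy).2 hcG
      have hHess : mhessian (𝓡 (k + 1)) Gn y = mhessian (𝓡∂ (k + 1)) g p := by
        rw [mhessian_congr_of_eventuallyEq_add_const hev, ← hGg',
          RegularSublevel.mhessian_comp_incl_eq h.isRegularLevel_triadFn G p hylt]
        rfl
      have hidx : morseIndex (𝓡 (k + 1)) Gn y = morseIndex (𝓡∂ (k + 1)) g p := by
        unfold morseIndex; rw [hHess]
      have hle : morseIndex (𝓡∂ (k + 1)) g p ≤ k := by
        have h1 : morseIndex (𝓡∂ (k + 1)) g p ≤ k + 1 := by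
          simpa [finrank_euclideanSpace_fin] using morseIndex_le_finrank (𝓡∂ (k + 1)) g p
        have h2 : morseIndex (𝓡∂ (k + 1)) g p ≠ k + 1 := by
          intro heq
          have : p ∈ criticalSetOfIndex (𝓡∂ (k + 1)) g (k + 1) := ⟨hcg, heq⟩
          rw [hgtop] at this
          exact this
        omega
      refine ⟨⟨hpos₁, hneg₂⟩, ?_, ?_⟩
      · rw [hHess]; exact hg.1.2 p hcg
      · rw [hidx]; exact hle

end IsRegularPair

/-! ### Phillips' Lemma 1.1 -/

omit [IsManifold (𝓡 (k + 1)) ∞ M] [SecondCountableTopology M] [T2Space M] in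
/-- On a manifold without compact components the compact hull of the empty set is empty.
[folklore] -/
theorem compactHull_empty_eq (hopen : ∀ x : M, ¬ IsCompact (connectedComponent x)) :
    Literature.Topology.compactHull (∅ : Set M) = ∅ := by
  refine eq_empty_of_forall_notMem fun x hx => ?_
  rcases Literature.Topology.mem_compactHull_iff.1 hx with h | ⟨-, h⟩
  · exact h
  · rw [compl_empty, connectedComponentIn_univ, isClosed_connectedComponent.closure_eq] at h
    exact hopen x h

/-- **Phillips 1967, Lemma 1.1.** *"An open `n`-dimensional manifold `M` has a non-negative,
proper Morse function with no critical points of index `n`."*  Here `M` is a `C^∞` manifold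
modelled on `ℝᵏ⁺¹` (`n = k + 1`), Hausdorff and second countable, and *open* means that no
connected component of `M` is compact (Phillips, p. 171); *proper* is `Tendsto f (cocompact M)
atTop` for the non-negative `f`, and the conclusion on the indices is stated as `index ≤ k`.
Proof as printed (p. 176): exhaust `M` by the compact hulls `Mᵢ'` of regular sublevel sets of
a proper Morse function (`ProperMorseFunction.lean`, `CompactHull.lean`,
`HullRegularSublevel.lean`); on each triad `(Mᵢ₊₁' - Int Mᵢ'; ∂Mᵢ', ∂Mᵢ₊₁')` take a Morse
function without critical points of index `k + 1` — Milnor 1965, Thm. 2.5, and Thm. 8.1 with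
`H₀(Mᵢ₊₁' - Int Mᵢ', ∂Mᵢ₊₁') = 0` *"satisfied by the construction of the `Mᵢ'`"*
(`OpenManifoldTriads.lean`); finally *"the `fᵢ` can be fitted together to give a non-negative,
proper Morse function `f` on `M`"*: `f = (i + 1) + Gᵢ` on the `i`-th triad with the normalised
functions `Gᵢ` of `IsRegularPair.exists_normalisedFn`, consecutive ones having the same slope
`λᵢ₊₁` at the common level `∂Mᵢ₊₁' = {Fᵢ₊₁ = 0}`, near which `f = (i + 2) + λᵢ₊₁ Fᵢ₊₁`.
[cite: Phillips1967, Lemma 1.1 (p. 176)]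
[cite: MilnorHCobordism1965, Thm. 2.5 and Thm. 8.1 (PDF pp. 6, 54)] -/
theorem exists_isMorse_tendsto_cocompact_forall_morseIndex_le
    (hopen : ∀ x : M, ¬ IsCompact (connectedComponent x)) :
    ∃ F : M → ℝ, IsMorse (𝓡 (k + 1)) F ∧ (∀ x, 0 ≤ F x) ∧ Tendsto F (cocompact M) atTop ∧
      ∀ x, IsMCriticalPt (𝓡 (k + 1)) F x → morseIndex (𝓡 (k + 1)) F x ≤ k := by
  classical
  -- a proper Morse function and its regular levels
  obtain ⟨f, hf, hf0, hft⟩ := exists_isMorse_tendsto_cocompact_atTop_euclidean (k + 1) M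
  obtain ⟨c, hcmono, hctop, hcreg⟩ := exists_strictMono_regularLevel_of_isMorse hf hft
  have hprop : ∀ b, IsCompact (f ⁻¹' Iic b) := fun b =>
    isCompact_preimage_Iic_of_tendsto_cocompact hf.1.continuous hft b
  -- the shifted levels: `c' 0` below all values of `f`, `c' (i + 1) = c i`
  set c' : ℕ → ℝ := fun i => if i = 0 then min (c 0) 0 - 1 else c (i - 1) with hc'
  have hc'0 : c' 0 = min (c 0) 0 - 1 := by simp [hc']
  have hc's : ∀ i, c' (i + 1) = c i := fun i => by simp [hc']
  have hc'0_lt : ∀ x, c' 0 < f x := fun x => by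
    rw [hc'0]; have := hf0 x; have := min_le_right (c 0) 0; linarith
  have P : ∀ i, IsRegularPair k f (c' i) (c' (i + 1)) := by
    intro i
    refine ⟨hopen, hf.1, ?_, ?_, ?_, ?_⟩
    · cases i with
      | zero => rw [hc'0, hc's]; have := min_le_left (c 0) 0; linarith
      | succ j => rw [hc's, hc's]; exact hcmono (Nat.lt_succ_self j)
    · rw [hc's]; exact hprop _
    · cases i with
      | zero => intro x hx; exact absurd hx (hc'0_lt x).ne'
      | succ j => rw [hc's]; exact hcreg j
    · rw [hc's]; exact hcreg i
  -- the level functions `L i = Fᵢ` (`{L i ≤ 0} = Mᵢ'`); `(P i).fn₂ = L (i + 1)` definitionally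
  set L : ℕ → M → ℝ := fun i => (P i).fn₁ with hL
  have hL₂ : ∀ i, (P i).fn₂ = L (i + 1) := fun i => rfl
  have hLs : ∀ i, ContMDiff (𝓡 (k + 1)) 𝓘(ℝ, ℝ) ∞ (L i) := fun i => (P i).contMDiff_fn₁
  -- (a) `L 0 > 0`: the hull of `{f ≤ c' 0} = ∅` is empty
  have hL0 : ∀ y, 0 < L 0 y := by
    intro y
    by_contra hle
    rw [not_lt] at hle
    have hmem : y ∈ (P 0).hull₁ := ((P 0).mem_hull₁_iff y).2 hle
    have hempty : (P 0).hull₁ = ∅ := by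
      show Literature.Topology.compactHull (f ⁻¹' Iic (c' 0)) = ∅
      rw [show f ⁻¹' Iic (c' 0) = ∅ from eq_empty_of_forall_notMem fun x hx =>
        absurd (mem_Iic.1 hx) (not_le.2 (hc'0_lt x)), compactHull_empty_eq hopen]
    rw [hempty] at hmem
    exact hmem
  -- (b) nesting `{L i ≤ 0} ⊆ {L (i + 1) < 0}`
  have hnest : ∀ i y, L i y ≤ 0 → L (i + 1) y < 0 := fun i y hy => by
    rw [← hL₂]; exact (P i).fn₂_neg_of_fn₁_nonpos hy
  have hnest' : ∀ i j y, i ≤ j → L i y ≤ 0 → L j y ≤ 0 := by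
    intro i j y hij hy
    induction hij with
    | refl => exact hy
    | step _ ih => exact (hnest _ y ih).le
  -- (c) the hulls cover `M`
  have hcover : ∀ y, ∃ i, L (i + 1) y ≤ 0 := by
    intro y
    obtain ⟨j, hj⟩ := (hctop.eventually (eventually_ge_atTop (f y))).exists
    refine ⟨j, ((P (j + 1)).mem_hull₁_iff y).1 ?_⟩
    show y ∈ Literature.Topology.compactHull (f ⁻¹' Iic (c' (j + 1)))
    rw [hc's]
    exact Literature.Topology.subset_compactHull _ (mem_Iic.2 hj)
  -- (d) the hulls are compact
  have hcpt : ∀ i, IsCompact {y | L i y ≤ 0} := by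
    intro i
    haveI : LocallyConnectedSpace M :=
      ChartedSpace.locallyConnectedSpace (EuclideanSpace ℝ (Fin (k + 1))) M
    haveI : LocallyCompactSpace M :=
      ChartedSpace.locallyCompactSpace (EuclideanSpace ℝ (Fin (k + 1))) M
    have : {y | L i y ≤ 0} = (P i).hull₁ := by
      ext y; exact ((P i).mem_hull₁_iff y).symm
    rw [this]
    exact Literature.Topology.isCompact_compactHull hopen (P i).isCompact₁
  -- the normalised triad functions with matching slopes
  choose Λ₁ Λ₂ hΛ₁ hΛ₂ hnorm using fun i => (P i).exists_normalisedFn hprop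
  set lam : ℕ → ℝ := fun i => min (Λ₁ i) (if i = 0 then Λ₁ 0 else Λ₂ (i - 1)) with hlam
  have hlam_pos : ∀ i, 0 < lam i := by
    intro i
    simp only [hlam]
    split_ifs
    · exact lt_min (hΛ₁ i) (hΛ₁ 0)
    · exact lt_min (hΛ₁ i) (hΛ₂ _)
  have hlam₁ : ∀ i, lam i ≤ Λ₁ i := fun i => min_le_left _ _
  have hlam₂ : ∀ i, lam (i + 1) ≤ Λ₂ i := fun i => by
    simp only [hlam, Nat.succ_ne_zero, ↓reduceIte, Nat.add_sub_cancel]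
    exact min_le_right _ _
  choose G δb δt hGs hδb hδt hbot htop hval hcritG using fun i =>
    hnorm i (lam i) (lam (i + 1)) (hlam_pos i) (hlam₁ i) (hlam_pos (i + 1)) (hlam₂ i)
  -- the index of a point: the least `i` with `L (i + 1) y ≤ 0`; then `0 < L i y`
  set ι : M → ℕ := fun y => Nat.find (hcover y) with hι
  have hι₁ : ∀ y, L (ι y + 1) y ≤ 0 := fun y => Nat.find_spec (hcover y)
  have hι₀ : ∀ y, 0 < L (ι y) y := by
    intro y
    cases hιy : ι y with
    | zero => exact hL0 y
    | succ m =>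
      have hm : m < Nat.find (hcover y) := by
        have : m < ι y := by rw [hιy]; exact Nat.lt_succ_self m
        exact this
      exact not_le.1 (Nat.find_min (hcover y) hm)
  have hιeq : ∀ y i, 0 < L i y → L (i + 1) y ≤ 0 → ι y = i := by
    intro y i h0 h1
    rw [hι, Nat.find_eq_iff]
    refine ⟨h1, fun j hj hle => ?_⟩
    exact absurd (hnest' (j + 1) i y hj hle) (not_le.2 h0)
  -- the global function
  set F : M → ℝ := fun y => (ι y : ℝ) + 1 + G (ι y) y with hF
  -- local forms: away from the levels, and on a two-sided neighbourhood of each level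
  have hlocA : ∀ x, L (ι x + 1) x < 0 →
      F =ᶠ[𝓝 x] fun y => G (ι x) y + ((ι x : ℝ) + 1) := by
    intro x hx
    have hopenU : IsOpen ({y | 0 < L (ι x) y} ∩ {y | L (ι x + 1) y < 0}) :=
      (isOpen_lt continuous_const (hLs _).continuous).inter
        (isOpen_lt (hLs _).continuous continuous_const)
    filter_upwards [hopenU.mem_nhds ⟨hι₀ x, hx⟩] with y hy
    have hy1 : 0 < L (ι x) y := hy.1
    have hy2 : L (ι x + 1) y < 0 := hy.2
    have : ι y = ι x := hιeq y (ι x) hy1 hy2.le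
    simp only [hF, this]; ring
  have hlocB : ∀ x, L (ι x + 1) x = 0 →
      F =ᶠ[𝓝 x] fun y => lam (ι x + 1) * L (ι x + 1) y + ((ι x : ℝ) + 2) := by
    intro x hx
    set i := ι x with hi
    have hx2 : L (i + 2) x < 0 := hnest (i + 1) x hx.le
    have hopenU : IsOpen ({y | 0 < L i y} ∩ {y | -δt i < L (i + 1) y} ∩
        {y | L (i + 1) y < δb (i + 1)} ∩ {y | L (i + 2) y < 0}) :=
      (((isOpen_lt continuous_const (hLs _).continuous).inter
        (isOpen_lt continuous_const (hLs _).continuous)).inter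
        (isOpen_lt (hLs _).continuous continuous_const)).inter
        (isOpen_lt (hLs _).continuous continuous_const)
    have hxU : x ∈ {y | 0 < L i y} ∩ {y | -δt i < L (i + 1) y} ∩
        {y | L (i + 1) y < δb (i + 1)} ∩ {y | L (i + 2) y < 0} := by
      refine ⟨⟨⟨hι₀ x, ?_⟩, ?_⟩, hx2⟩
      · show -δt i < L (i + 1) x; rw [hx]; exact neg_neg_of_pos (hδt i)
      · show L (i + 1) x < δb (i + 1); rw [hx]; exact hδb (i + 1)
    filter_upwards [hopenU.mem_nhds hxU] with y hy
    obtain ⟨⟨⟨hy0, hyt⟩, hyb⟩, hy2⟩ := hy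
    have hy0 : 0 < L i y := hy0
    have hyt : -δt i < L (i + 1) y := hyt
    have hyb : L (i + 1) y < δb (i + 1) := hyb
    have hy2 : L (i + 2) y < 0 := hy2
    rcases le_or_gt (L (i + 1) y) 0 with hle | hgt
    · have hιy : ι y = i := hιeq y i hy0 hle
      have := htop i y (by rw [hL₂]; exact hyt.le)
      rw [hL₂] at this
      simp only [hF, hιy, this]; ring
    · have hιy : ι y = i + 1 := hιeq y (i + 1) hgt hy2.le
      have := hbot (i + 1) y hyb.le
      simp only [hF, hιy, this]; push_cast; ring
  -- smoothness
  have hFs : ContMDiff (𝓡 (k + 1)) 𝓘(ℝ, ℝ) ∞ F := by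
    intro x
    rcases (hι₁ x).lt_or_eq with hlt | heq
    · exact ((hGs _).add contMDiff_const).contMDiffAt.congr_of_eventuallyEq (hlocA x hlt)
    · exact ((contMDiff_const.mul (hLs _)).add contMDiff_const).contMDiffAt.congr_of_eventuallyEq
        (hlocB x heq)
  -- critical points: only away from the levels, where they are those of the `Gᵢ`
  have hcritF : ∀ x, IsMCriticalPt (𝓡 (k + 1)) F x →
      L (ι x + 1) x < 0 ∧ IsMCriticalPt (𝓡 (k + 1)) (G (ι x)) x := by
    intro x hx
    rcases (hι₁ x).lt_or_eq with hlt | heq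
    · exact ⟨hlt, (isMCriticalPt_congr_of_eventuallyEq_add_const (hlocA x hlt)).1 hx⟩
    · exfalso
      have h1 := (isMCriticalPt_congr_of_eventuallyEq_add_const (hlocB x heq)).1 hx
      rw [LevelBlending.isMCriticalPt_const_mul_iff (hlam_pos _).ne'
        ((hLs _).mdifferentiableAt (by simp))] at h1
      exact (P (ι x + 1)).not_isMCriticalPt_fn₁ heq h1
  refine ⟨F, ⟨hFs, fun x hx => ?_⟩, fun x => ?_, ?_, fun x hx => ?_⟩
  · -- nondegenerate
    obtain ⟨hlt, hcG⟩ := hcritF x hx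
    rw [mhessian_congr_of_eventuallyEq_add_const (hlocA x hlt)]
    exact (hcritG (ι x) x (hι₀ x).le (by rw [hL₂]; exact hι₁ x) hcG).2.1
  · -- non-negative
    have := (hval (ι x) x (hι₀ x).le (by rw [hL₂]; exact hι₁ x)).1
    simp only [hF]; positivity
  · -- proper
    rw [tendsto_atTop]
    intro b
    obtain ⟨m, hm⟩ := exists_nat_ge b
    rw [Filter.Eventually, Filter.mem_cocompact]
    refine ⟨{y | L m y ≤ 0}, hcpt m, fun y hy => ?_⟩
    have hy' : 0 < L m y := not_le.1 hy
    have hmι : m ≤ ι y := by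
      by_contra hlt
      rw [not_le] at hlt
      exact absurd (hnest' (ι y + 1) m y hlt (hι₁ y)) (not_le.2 hy')
    have h0 := (hval (ι y) y (hι₀ y).le (by rw [hL₂]; exact hι₁ y)).1
    have hmι' : (m : ℝ) ≤ ι y := by exact_mod_cast hmι
    show b ≤ (ι y : ℝ) + 1 + G (ι y) y
    linarith
  · -- indices
    obtain ⟨hlt, hcG⟩ := hcritF x hx
    unfold morseIndex
    rw [mhessian_congr_of_eventuallyEq_add_const (hlocA x hlt)]
    exact (hcritG (ι x) x (hι₀ x).le (by rw [hL₂]; exact hι₁ x) hcG).2.2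

/-- **Phillips 1967, Lemma 1.1, with the conclusion as printed**: a non-negative proper Morse
function with **no critical points of index `k + 1 = dim M`**.
[cite: Phillips1967, Lemma 1.1 (p. 176)] -/
theorem exists_isMorse_tendsto_cocompact_criticalSetOfIndex_top_eq_empty
    (hopen : ∀ x : M, ¬ IsCompact (connectedComponent x)) :
    ∃ F : M → ℝ, IsMorse (𝓡 (k + 1)) F ∧ (∀ x, 0 ≤ F x) ∧ Tendsto F (cocompact M) atTop ∧
      criticalSetOfIndex (𝓡 (k + 1)) F (k + 1) = ∅ := by
  obtain ⟨F, hF, hF0, hFt, hidx⟩ :=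
    exists_isMorse_tendsto_cocompact_forall_morseIndex_le (k := k) (M := M) hopen
  refine ⟨F, hF, hF0, hFt, eq_empty_of_forall_notMem fun x hx => ?_⟩
  have := hidx x hx.1
  rw [hx.2] at this
  omega

end Literature.Topology.FourManifolds
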